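import Summits.Ventures.AbcSig.Rows.TemplateCE
import Summits.Ventures.AbcSig.Rows.XTemplateB

/-!
# Venture AbcSig — EXTENDED-EXCLUSION twin of `Rows/TemplateCE.lean` (`xⁿ + yⁿ = C z²`, `C = 2C'` even)

HONEST FRAMING. Template file of a COMPUTATION cell (`pub-abcsig`); CONDITIONAL theorem, no claim on ABC or any summit.
`xrow_template_evenC` is `row_template_evenC` with the per-orbit alternative
`o.Eliminated bs04Allowed n ∨ (M.Excludes N o fam ∨ M.ExcludesStd N o n)` (so that module certificates discharged in the
kernel — M6/M6χ `ExcludesStd`, M4 tables, charpoly norm kills `Sieve/CharpolySieve.lean` — can be plugged in), final step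
`xno_solution_in_case` of `Rows/XTemplateB.lean`. First consumer: the C = 14 row (level 12544).
-/

namespace Summit.Ventures.AbcSig

/-- **Row template, `C = 2C'` even squarefree, EXTENDED per-orbit alternative** (`Eliminated ∨ (Excludes ∨ ExcludesStd)`, final step `xno_solution_in_case`). (`C` and `C'` both given, `hC : C = 2 * C'`, so that rows state the
conclusion with the literal `C`). For odd squarefree `C'`, a prime `n ≥ 7` with `n ∤ C'`, and the
cell's hypotheses at level `256·C'²` for this `n` (package; data; per orbit a kernel certificate or a cited exclusion
for the family "`(1, 1, 2C')`, exponent `n`"), there is no primitive solution of `xⁿ + yⁿ = 2C' z²` with `xy ≠ ±1`. -/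
theorem xrow_template_evenC (C C' : ℕ) (hC : C = 2 * C') (hsq : Squarefree C') (hodd : Odd C') (M : NewformModel)
    (hP : M.BS04Package) {orbs : List OrbitData} (hD : M.DataComplete (256 * C' ^ 2) orbs) (n : ℕ) (hn : n.Prime)
    (h7 : 7 ≤ n) (hnC : ¬ n ∣ C')
    (hS : ∀ o ∈ orbs, (∀ e ∈ o.coeffs, e.ell.Prime ∧ e.ell ≠ 2 ∧ ¬ e.ell ∣ 256 * C' ^ 2) ∧
      (o.Eliminated bs04Allowed n ∨ (M.Excludes (256 * C' ^ 2) o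
        (fun S => S.A = 1 ∧ S.B = 1 ∧ S.C = C ∧ S.n = n) ∨ M.ExcludesStd (256 * C' ^ 2) o n)))
    (a b c : ℤ) (h1 : a * b ≠ 1) (h2 : a * b ≠ -1) : ¬ IsPrimitiveSolution 1 1 C n a b c := by
  subst hC
  intro hsol
  have hC'pos : 0 < C' := hodd.pos
  have hab : ¬ 2 ∣ a * b := odd_ab_of_even_C (by omega) hsol
  have hord : OrdTwoEq (((2 * C' : ℕ) : ℤ)) 1 := by
    obtain ⟨k, hk⟩ := hodd
    refine ⟨⟨C', by push_cast; ring⟩, ?_⟩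
    rintro ⟨m, hm⟩
    push_cast at hm
    omega
  have hcase : FreyCase.Holds .iiC 1 1 (2 * C') n a b c := ⟨hab, hord⟩
  have hsqC : Squarefree (2 * C') := by
    rw [Nat.squarefree_mul]
    · exact ⟨Nat.prime_two.squarefree, hsq⟩
    · exact (Nat.coprime_two_left).mpr hodd
  have hndvd : ¬ n ∣ 1 * 1 * (2 * C') := by
    intro h
    rw [one_mul, one_mul] at h
    rcases (Nat.Prime.dvd_mul hn).mp h with h2 | hC
    · have := (Nat.prime_dvd_prime_iff_eq hn Nat.prime_two).mp h2
      omega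
    · exact hnC hC
  have hfree : ∀ q : ℕ, q.Prime → ¬ q ^ n ∣ 1 ∧ ¬ q ^ n ∣ 1 := by
    intro q hq
    have : ¬ q ^ n ∣ 1 := by
      intro h
      have h1 := Nat.dvd_one.mp h
      rw [Nat.pow_eq_one] at h1
      rcases h1 with h1 | h1
      · exact hq.one_lt.ne' h1
      · omega
    exact ⟨this, this⟩
  exact xno_solution_in_case M hP ⟨1, 1, 2 * C', n, a, b, c⟩ .iiC (256 * C' ^ 2) one_pos one_pos (by positivity)
    hsqC hn h7 hndvd hfree hsol h1 h2 hcase (bs04Level_one_one_twice C' n hsq hodd hnC) hD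
    (fun S => S.A = 1 ∧ S.B = 1 ∧ S.C = 2 * C' ∧ S.n = n) ⟨rfl, rfl, rfl, rfl⟩ hS

end Summit.Ventures.AbcSig
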